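import Mathlib.Analysis.InnerProductSpace.PiL2
import Literature.MathematicalPhysics.QuantumFieldTheory.Balaban1983to89.B4Eq19LatticeOperators
import Summits.QuantumFields.YangMills.Theorems.PoincareLipschitzLeungXinGraphStability
import HarnessLib

/-!
# Crux `HistoryTailL` (stmt-QuantumFields-19936), K2 organ `hImproveCore` (FROZEN v1 7446c95a): THE DICTIONARY BETWEEN THE ORGAN'S LETTERS
# (`EuclideanSpace ℝ (Fin 4)`, bond twists `τ : E⁴ ≃ₗᵢ[ℝ] E⁴`) AND THE STABILITY LETTERS (`Fin 4 → ℝ`, `dotProduct`, orthogonal matrices acting by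
# `(S_b)ᵀ *ᵥ`) — inner products, norms, the STANDARD MATRIX of a linear isometry, its orthogonality and Frobenius defect, the twisted bond energy

Cell `ym3-torus` (YM ladder rung R3 = continuum SU(2) Yang–Mills on the three-torus — a RUNG, NOT the Clay problem: not d = 4, not infinite
volume, not a mass gap), WIDTH seat `ym-ust-19936-w3` gen 14; `--supports stmt-QuantumFields-19936 --as helper`; THEOREMS ONLY, definition-free.
Imports `Mathlib.Analysis.InnerProductSpace.PiL2` + lit ✓`B4Eq19LatticeOperators` (`Zd`) + ✓`…LeungXinGraphStability` (for `varied_dot_self`) + HarnessLib.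

WHY.  Every stability letter of the cell (✓`graph_stability`, ✓`twisted_graph_stability_eps`, ✓`exists_scale_energy_le`) is written for maps
`u : V → Fin 4 → ℝ` with `dotProduct` and bond twists `S_b : Matrix (Fin 4) (Fin 4) ℝ`, `S_bS_bᵀ = 1`, acting on the target end by `(S_b)ᵀ *ᵥ`; the K2
organ of record (`hImproveCore`∕`hImprove`, LEAD ★w1-19936 g9) is written for `u : ℤ³ → EuclideanSpace ℝ (Fin 4)` with `‖·‖`, `⟪·,·⟫` and twists
`τ μ y : E⁴ ≃ₗᵢ[ℝ] E⁴`.  This file is the one-way dictionary organ → stability letters: `x ↦ ofLp x`, `T ↦ M_T := (i, j) ↦ (T e_j)_i` (so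
`ofLp (T w) = M_T *ᵥ ofLp w`, ★`ofLp_map_eq_mulVec`), `S := M_Tᵀ` is orthogonal (★`transpose_mul_self_eq_one`, from `⟪T e_j, T e_k⟫ = δ_{jk}`), its
Frobenius defect is `Σ_j ‖T e_j − e_j‖² ≤ 4τ₀²` under the organ's defect row `‖T w − w‖ ≤ τ₀‖w‖` (★`frob_transpose_le`), and the organ's bond
energy ∕ correlation read `|w − M w′|²` ∕ `w·(M w′)` (`norm_sub_sq_eq_dot`, `inner_map_eq_dot`, `norm_sub_sq_eq_two_sub`).  §2: the Leung–Xin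
varied point pulled back to `E⁴` is a unit vector and equals `u x` where the cutoff vanishes.  Consumer: ⧗`…ImproveCoreOfCapped`
(`hImproveCore∣_{Λ₀:=c} ⟹ hImproveCore`), and any later supplier of the organ that works in the stability letters.

WHAT (ns `…Theorems.PoincareLipschitzEuclideanTwistDictionary`).
* §1 `inner_eq_dot`, `norm_sq_eq_dot`, `dot_self_eq_one_of_norm`, `norm_eq_one_of_dot`, ★`ofLp_map_eq_mulVec`, ★`transpose_mul_self_eq_one`,
  ★`frob_transpose_le`, `norm_sub_sq_eq_dot`, `inner_map_eq_dot`, `norm_sub_sq_eq_two_sub`.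
* §2 `norm_eq_one_of_ofLp_eq_varied`, `eq_of_ofLp_eq_varied_of_zero`.
HONEST SCOPE.  Linear algebra of `ℝ⁴`; nothing of `hImproveCore(Flat)`, `hImprove`, K1-exp, `MeanDeviationL`, `BlockLipschitzL`, `HistoryTailL` or any
summit statement is proved.  YM₃ on T³ is rung R3, NOT the Clay problem.

References: Y. L. Xin, Duke Math. J. **47** (1980) 609–613 [Xin1980] (the conformal variations); T. Bałaban, Commun. Math. Phys. **98** (1985) 17–51
[Balaban1985Averaging] §3 (lattice letters' provenance).
-/

set_option autoImplicit false

noncomputable section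

open scoped BigOperators InnerProductSpace
open Finset Matrix WithLp

namespace Summit.QuantumFields.YangMills.Theorems.PoincareLipschitzEuclideanTwistDictionary

open Literature.MathematicalPhysics.QuantumFieldTheory.Balaban1983to89.B4Eq19LatticeOperators (Zd)
open Summit.QuantumFields.YangMills.Theorems.PoincareLipschitzLeungXinGraphStability (varied_dot_self)

/-! ## §1 The dictionary `EuclideanSpace ℝ (Fin 4)` ↔ `Fin 4 → ℝ`: inner products, norms, the matrix of a linear isometry -/

/-- Real inner product on `E⁴` = dot product of the coordinate vectors. [folklore] -/
theorem inner_eq_dot (x y : EuclideanSpace ℝ (Fin 4)) : ⟪x, y⟫_ℝ = dotProduct (ofLp x) (ofLp y) := by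
  rw [EuclideanSpace.inner_eq_star_dotProduct, star_trivial, dotProduct_comm]

/-- `‖x‖² = x·x` in coordinates. [folklore] -/
theorem norm_sq_eq_dot (x : EuclideanSpace ℝ (Fin 4)) : ‖x‖ ^ 2 = dotProduct (ofLp x) (ofLp x) := by
  rw [← real_inner_self_eq_norm_sq, inner_eq_dot]

/-- Unit vectors of `E⁴` have unit coordinate dot square. [folklore] -/
theorem dot_self_eq_one_of_norm {x : EuclideanSpace ℝ (Fin 4)} (hx : ‖x‖ = 1) : dotProduct (ofLp x) (ofLp x) = 1 := by
  rw [← norm_sq_eq_dot, hx, one_pow]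

/-- Conversely, unit dot square gives unit norm. [folklore] -/
theorem norm_eq_one_of_dot {x : EuclideanSpace ℝ (Fin 4)} (hx : dotProduct (ofLp x) (ofLp x) = 1) : ‖x‖ = 1 := by
  have h := norm_sq_eq_dot x
  rw [hx] at h
  have h0 : 0 ≤ ‖x‖ := norm_nonneg x
  nlinarith [h, h0]

/-- The coordinates of `T w` are the standard matrix of `T` (column `j` = coordinates of `T e_j`) applied to the coordinates of `w`. [folklore] -/
theorem ofLp_map_eq_mulVec (T : EuclideanSpace ℝ (Fin 4) ≃ₗᵢ[ℝ] EuclideanSpace ℝ (Fin 4)) (w : EuclideanSpace ℝ (Fin 4)) :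
    ofLp (T w) = (Matrix.of fun i j => ofLp (T (EuclideanSpace.single j (1 : ℝ))) i) *ᵥ ofLp w := by
  have hw : w = ∑ j : Fin 4, (ofLp w j) • EuclideanSpace.single j (1 : ℝ) := by
    have := (EuclideanSpace.basisFun (Fin 4) ℝ).sum_repr w
    simp only [EuclideanSpace.basisFun_repr, EuclideanSpace.basisFun_apply] at this
    exact this.symm
  conv_lhs => rw [hw]
  rw [map_sum]
  funext i
  simp only [map_smul, WithLp.ofLp_sum, WithLp.ofLp_smul, Finset.sum_apply, Pi.smul_apply, smul_eq_mul, Matrix.mulVec,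
    dotProduct, Matrix.of_apply]
  exact Finset.sum_congr rfl fun j _ => mul_comm _ _

/-- The standard matrix of a linear isometry of `E⁴` is orthogonal: `MᵀM = 1`, i.e. `(Mᵀ)(Mᵀ)ᵀ = 1`. [folklore] -/
theorem transpose_mul_self_eq_one (T : EuclideanSpace ℝ (Fin 4) ≃ₗᵢ[ℝ] EuclideanSpace ℝ (Fin 4)) :
    (Matrix.of fun i j => ofLp (T (EuclideanSpace.single j (1 : ℝ))) i)ᵀ *
      ((Matrix.of fun i j => ofLp (T (EuclideanSpace.single j (1 : ℝ))) i)ᵀ)ᵀ = 1 := by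
  rw [Matrix.transpose_transpose]
  ext j k
  rw [Matrix.mul_apply, Matrix.one_apply]
  have h : ∑ i : Fin 4, (Matrix.of fun i j => ofLp (T (EuclideanSpace.single j (1 : ℝ))) i)ᵀ j i *
      (Matrix.of fun i j => ofLp (T (EuclideanSpace.single j (1 : ℝ))) i) i k =
      dotProduct (ofLp (T (EuclideanSpace.single j (1 : ℝ)))) (ofLp (T (EuclideanSpace.single k (1 : ℝ)))) := by
    simp only [Matrix.transpose_apply, Matrix.of_apply, dotProduct]
  rw [h, ← inner_eq_dot, LinearIsometryEquiv.inner_map_map, EuclideanSpace.inner_single_left, map_one, one_mul,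
    PiLp.single_apply]

/-- The Frobenius deviation of the standard matrix from the identity is `Σ_j ‖T e_j − e_j‖²`, hence `≤ 4τ₀²` under the defect bound
`‖T w − w‖ ≤ τ₀‖w‖`. [folklore] -/
theorem frob_transpose_le (T : EuclideanSpace ℝ (Fin 4) ≃ₗᵢ[ℝ] EuclideanSpace ℝ (Fin 4)) {τ₀ : ℝ}
    (hT : ∀ w : EuclideanSpace ℝ (Fin 4), ‖T w - w‖ ≤ τ₀ * ‖w‖) :
    ∑ a : Fin 4, ∑ i : Fin 4, ((Matrix.of fun i j => ofLp (T (EuclideanSpace.single j (1 : ℝ))) i)ᵀ a i -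
      (1 : Matrix (Fin 4) (Fin 4) ℝ) a i) ^ 2 ≤ 4 * τ₀ ^ 2 := by
  have hcol : ∀ a : Fin 4, ∑ i : Fin 4, ((Matrix.of fun i j => ofLp (T (EuclideanSpace.single j (1 : ℝ))) i)ᵀ a i -
      (1 : Matrix (Fin 4) (Fin 4) ℝ) a i) ^ 2 = ‖T (EuclideanSpace.single a (1 : ℝ)) - EuclideanSpace.single a (1 : ℝ)‖ ^ 2 := by
    intro a
    rw [norm_sq_eq_dot, WithLp.ofLp_sub, PiLp.ofLp_single]
    simp only [dotProduct, Pi.sub_apply, Matrix.transpose_apply, Matrix.of_apply, Matrix.one_apply, Pi.single_apply, sq]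
    refine Finset.sum_congr rfl fun i _ => ?_
    by_cases h : a = i
    · subst h; simp
    · have h' : ¬ i = a := fun h'' => h h''.symm
      simp [h, h']
  have hτ : ∀ a : Fin 4, ‖T (EuclideanSpace.single a (1 : ℝ)) - EuclideanSpace.single a (1 : ℝ)‖ ^ 2 ≤ τ₀ ^ 2 := by
    intro a
    have h1 := hT (EuclideanSpace.single a (1 : ℝ))
    rw [PiLp.norm_single, norm_one, mul_one] at h1
    exact pow_le_pow_left₀ (norm_nonneg _) h1 2
  calc _ = ∑ a : Fin 4, ‖T (EuclideanSpace.single a (1 : ℝ)) - EuclideanSpace.single a (1 : ℝ)‖ ^ 2 := Finset.sum_congr rfl fun a _ => hcol a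
    _ ≤ ∑ _a : Fin 4, τ₀ ^ 2 := Finset.sum_le_sum fun a _ => hτ a
    _ = 4 * τ₀ ^ 2 := by rw [Finset.sum_const, Finset.card_univ, Fintype.card_fin]; ring

/-- The twisted bond energy in coordinates: `‖T w′ − w‖² = |w − Mw′|²` with `M` the standard matrix of `T` (`= ((Mᵀ))ᵀ`). [folklore] -/
theorem norm_sub_sq_eq_dot (T : EuclideanSpace ℝ (Fin 4) ≃ₗᵢ[ℝ] EuclideanSpace ℝ (Fin 4)) (w w' : EuclideanSpace ℝ (Fin 4)) :
    ‖T w' - w‖ ^ 2 = dotProduct (ofLp w - ((Matrix.of fun i j => ofLp (T (EuclideanSpace.single j (1 : ℝ))) i)ᵀ)ᵀ *ᵥ ofLp w')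
      (ofLp w - ((Matrix.of fun i j => ofLp (T (EuclideanSpace.single j (1 : ℝ))) i)ᵀ)ᵀ *ᵥ ofLp w') := by
  rw [norm_sub_rev, norm_sq_eq_dot, WithLp.ofLp_sub, ofLp_map_eq_mulVec, Matrix.transpose_transpose]

/-- The twisted correlation in coordinates: `⟪w, T w′⟫ = w · (M w′)`. [folklore] -/
theorem inner_map_eq_dot (T : EuclideanSpace ℝ (Fin 4) ≃ₗᵢ[ℝ] EuclideanSpace ℝ (Fin 4)) (w w' : EuclideanSpace ℝ (Fin 4)) :
    ⟪w, T w'⟫_ℝ = dotProduct (ofLp w) (((Matrix.of fun i j => ofLp (T (EuclideanSpace.single j (1 : ℝ))) i)ᵀ)ᵀ *ᵥ ofLp w') := by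
  rw [Matrix.transpose_transpose, ← ofLp_map_eq_mulVec, inner_eq_dot]

/-- For unit `w` and unit `w′`, `‖T w′ − w‖² = 2 − 2⟪w, T w′⟫`. [folklore] -/
theorem norm_sub_sq_eq_two_sub (T : EuclideanSpace ℝ (Fin 4) ≃ₗᵢ[ℝ] EuclideanSpace ℝ (Fin 4)) {w w' : EuclideanSpace ℝ (Fin 4)}
    (hw : ‖w‖ = 1) (hw' : ‖w'‖ = 1) : ‖T w' - w‖ ^ 2 = 2 - 2 * ⟪w, T w'⟫_ℝ := by
  rw [@norm_sub_sq_real, LinearIsometryEquiv.norm_map, hw, hw', real_inner_comm]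
  ring


/-! ## §2 The Leung–Xin varied point, pulled back to `E⁴` -/

/-- A vector of `E⁴` whose coordinates are the Leung–Xin varied point is unit-valued. [folklore] -/
theorem norm_eq_one_of_ofLp_eq_varied (u : Zd 3 → EuclideanSpace ℝ (Fin 4)) (hu : ∀ y, ‖u y‖ = 1) (η : Zd 3 → ℝ) (a : Fin 4) (t : ℝ)
    (x : Zd 3) (w : EuclideanSpace ℝ (Fin 4))
    (hw : ofLp w = (Real.sqrt (1 + t ^ 2 * dotProduct (η x • (Pi.single a 1 - dotProduct (Pi.single a 1) (ofLp (u x)) • ofLp (u x)))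
        (η x • (Pi.single a 1 - dotProduct (Pi.single a 1) (ofLp (u x)) • ofLp (u x)))))⁻¹ •
      (ofLp (u x) + t • (η x • (Pi.single a 1 - dotProduct (Pi.single a 1) (ofLp (u x)) • ofLp (u x))))) : ‖w‖ = 1 := by
  apply norm_eq_one_of_dot
  rw [hw]
  exact varied_dot_self (fun y => ofLp (u y)) (fun y => dot_self_eq_one_of_norm (hu y)) η a t x

/-- Where the cutoff vanishes the varied point is the original point. [folklore] -/
theorem eq_of_ofLp_eq_varied_of_zero (u : Zd 3 → EuclideanSpace ℝ (Fin 4)) {η : Zd 3 → ℝ} (a : Fin 4) (t : ℝ) {x : Zd 3} (hx : η x = 0)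
    (w : EuclideanSpace ℝ (Fin 4))
    (hw : ofLp w = (Real.sqrt (1 + t ^ 2 * dotProduct (η x • (Pi.single a 1 - dotProduct (Pi.single a 1) (ofLp (u x)) • ofLp (u x)))
        (η x • (Pi.single a 1 - dotProduct (Pi.single a 1) (ofLp (u x)) • ofLp (u x)))))⁻¹ •
      (ofLp (u x) + t • (η x • (Pi.single a 1 - dotProduct (Pi.single a 1) (ofLp (u x)) • ofLp (u x))))) : w = u x := by
  apply WithLp.ofLp_injective 2
  rw [hw, hx, zero_smul, smul_zero, add_zero, dotProduct_zero, mul_zero, add_zero, Real.sqrt_one, inv_one, one_smul]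

end Summit.QuantumFields.YangMills.Theorems.PoincareLipschitzEuclideanTwistDictionary

end
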